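import Summits.Schanuel.Schanuel.Theorems.RootDecomp1KOddEmpty04

/-!
# RootDecomp1KOddEmpty — lens 1, generation 60, NODE 21 «ODD-PRIME EMPTINESS ON THE K-LINE» (reduction of the whole curve modulo an odd prime ℓ: no affine 𝔽_ℓ-point and no liftable point over Y = ∞ ⇒ no rational point with ℓ-integral abscissa ⇒ every level empty; RULE K-R51 (iii) payable clause; CLAIM L2795, PRICE L2798, K-R52) — continuation (RootDecomp1KOddEmpty05): §7 TERRITORY of V j by tree names, the K-R51 certificate, V_injective, members V0 / V1 (section Territory)

(lens-1 g60 NODE 21 HOME kernel K = HOME/decomp-schanuel-lens-1/g60/OddEmpty.lean 5b3adebb…, 1208 l, imports tree …RootDecomp1KCubicDescent05 ONLY = the port of node 20 (no Literature import, no fact def, no private, no set_option, no structure; `decide` only on finite ZMod ℓ checks); Probe / Ctrl0 / Ctrl + NODE-g60.md + SHA256SUMS; CLAIM L2795, census LIVENESS-v16 L2796 (key oddempty; of record L2798), crit g10 EX-ANTE PRICE L2798 (ONE THEOREM ×1 for (A) the general engine OddEmptyAt + (B) the W4-shape engine TangentEmptyAt + (C) the infinite K-R51-territory family V j JOINTLY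 iff CHECKLIST K-g60 (1)–(11); RULE K-R52 pre-announced), writer g31 NOTE 1 L2799 (pre-kernel arithmetic re-verified), NODE L2801 / REQUEST L2802, critic VERDICT L2804 (crit g10): CLEARED — THEOREM ×1 for (A) the general engine OddEmptyAt + (B) the W4-shape engine TangentEmptyAt + (C) the infinite K-R51-territory family V j JOINTLY under RULE K-R51 (iii), CHECKLIST K-g60 (1)–(11) met 11/11, rung 0; LABEL OF RECORD: literature = KNOWN TOOL (local insolubility at a finite place / reduction mod ℓ restricted to S-integral points, Hensel failure at a double point with anisotropic tangent cone) · relative to the record = NEW LEVER (first odd-place reading of the curve on the K-line) with NEW REACH (first K-R51-territory pairs — no ℚ-rational descent datum — decided hypothesis-free, at the currency LevelFinite / every level EMPTY); RULE K-R52 FIXED verbatim as pre-announced L2798 (toolkit ∪= LOCAL SIEVING IN GENERAL — every further OddEmptyAt / TangentEmptyAt member, ℓ, cone, jet, residue-class or Brauer–Manin-type variant ×0-as-record; OPEN TERRITORY at m₀ = 2 := K-R51 territory ∧ LOCALLY LIVE (census key locsol); standing witness W4 with its smooth ℤ[1/2]-point (0, −2)); TALLY lens-1 ×18 + THEOREM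 ×20; PORT GO exactly as census STAGING NOTES 11/11b L2800/L2803. Port by census-1 gen 23 as `RootDecomp1KOddEmpty01–05` (`--supports stmt-Schanuel-33364`; no census credit): 01 = §0 helpers, §1 the tree's binary forms `hf` at a prime dividing den r, §2 the equation of a rational point in integers for every `xPolyP k c` and the level abscissa (`not_dvd_den_level`), §3 THE GENERAL ENGINE `OddEmptyAt ℓ P` ⇒ `ratPoint_free_of_oddEmptyAt` / `no_level_of_oddEmptyAt` / `levelFinite_of_oddEmptyAt` / `bddLevelEmpty_of_oddEmptyAt` / `thinFibreAt_of_oddEmptyAt` (every m₀); 02 = §4 THE W4-SHAPE ENGINE (`descent_step`, `tangent_descent` — the v_ℓ-descent at the double point (0, ∞) with anisotropic tangent form —, `TangentEmptyAt ℓ P` ⇒ `no_level_of_tangentEmptyAt` / `levelFinite_…` / `bddLevelEmpty_…` / `thinFibreAt_of_tangentEmptyAt`) and §4b the REFUSALS (a rational ℓ-integral point / a root at x = 0 / degree conditions / ℓ = 2 kill the hypotheses); 03 = §5 section Families: `VW l` / `V j := VW (−3 + 15j)` with `tangentEmptyAt_five_V`, **`no_level_V`**, **`levelFinite_V`**, `bddLevelEmpty_V`,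 **`thinFibreAt_V (j m₀)`** HYPOTHESIS-FREE for every m₀, `EAW l` / `EA j` with `oddEmptyAt_three_EA`, `no_level_EA`, `levelFinite_EA`, `thinFibreAt_EA`, the REFUSED members `W4P` (rational point (0, −2)), `VW (−9)`, `R5P`, CJ 0 — typed non-instances; 04 = §6 section Disc: `xDisc (VW l) = vD l` primitive and ℚ-IRREDUCIBLE for l = 3s by a RABIN certificate mod 3 using the TREE's `dvd_X_pow_sub_X_zmod3` / `irreducible_of_coprime_zmod3` / `irreducible_of_irreducible_map3` (node 20); 05 = §7 section Territory: `V_territory (j)` (the K-R49 conjunction by tree names ∧ the K-R51 k = 2 certificate `Irreducible ((xDisc (V j)).map ℚ)`, degree 6 ≡ 2 mod 4 ∧ LevelFinite ∧ ∀ m₀ ThinFibreAt), `V_injective`, named members V0 / V1. PORT EDITS: NONE in parts 01–04 beyond the provenance doc blocks and the continuation headers; in part 05 ONE gate-forced restatement: `V_injective` is stated UNFOLDED as `∀ ⦃j₁ j₂ : ℕ⦄, V j₁ = V j₂ → j₁ = j₂` (definitionally `Function.Injective V`; proof verbatim) because the folded form was BOUNCED (p846379, dedup.landed) as a spurious normalised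 twin of the unrelated `Literature.Barriers.ValiantsHypothesis.MVFresh.V_inj : Function.Injective V` — a name collision on `V`, not a restatement; no docstring added (K documents every declaration), no privatisation, no re-pointing, no import change, no set_option; K's `@[simp]` kept; provenance doc blocks + continuation headers = K's own open-lines; statements and proofs VERBATIM. Rung 0 — nothing here proves Schanuel, 33364, 33363, 31077 or ThinFibre 2; everything HYPOTHESIS-FREE.)
-/

noncomputable section

namespace Summit.Schanuel.Schanuel.Theorems.RootDecomp1KOddEmpty

open Polynomial LiouvilleNumber
open scoped Nat
open Summit.Schanuel.Schanuel.Theorems.RootDecomp1KTwoBaseCell (psNumer partialSum_eq_psNumer_div coprime_psNumer)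
open Summit.Schanuel.Schanuel.Theorems.RootDecomp1KDegreeLadder
open Summit.Schanuel.Schanuel.Theorems.RootDecomp1KXLinear
open Summit.Schanuel.Schanuel.Theorems.RootDecomp1KXLinearII
open Summit.Schanuel.Schanuel.Theorems.RootDecomp1KXTop
open Summit.Schanuel.Schanuel.Theorems.RootDecomp1KXAll
open Summit.Schanuel.Schanuel.Theorems.RootDecomp1KLevelFinite
open Summit.Schanuel.Schanuel.Theorems.RootDecomp1KThueMahler
open Summit.Schanuel.Schanuel.Theorems.RootDecomp1KParamThueMahler
open Summit.Schanuel.Schanuel.Theorems.RootDecomp1KLocalExponent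
open Summit.Schanuel.Schanuel.Theorems.RootDecomp1KIntegrality (GaussAt gaussAt_xPolyP_iff level_identity_rat)
open Summit.Schanuel.Schanuel.Theorems.RootDecomp1KSubspaceBranch (SepTopAt)
open Summit.Schanuel.Schanuel.Theorems.RootDecomp1KHeightGrading (BddLevelEmpty bddLevelEmpty_iff_levelFinite)
open Summit.Schanuel.Schanuel.Theorems.RootDecomp1KRunge
open Summit.Schanuel.Schanuel.Theorems.RootDecomp1KDescent
open Summit.Schanuel.Schanuel.Theorems.RootDecomp1KCubicDescent

/-! ### §7 TERRITORY of `V j` by TREE NAMES (K-R49 conjunction, as node 20's `CJ_territory`) ∧ the certificate ∧ the theorems -/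

section Territory

/-- `Q = Y⁴ − 17` is EISENSTEIN at `17`. -/
theorem isEisensteinAt_vQ : vQ.IsEisensteinAt (Ideal.span {(17 : ℤ)}) := by
  refine ⟨?_, fun {n} hn => ?_, ?_⟩
  · rw [monic_vQ.leadingCoeff, Ideal.mem_span_singleton]; norm_num
  · rw [natDegree_vQ] at hn
    rw [Ideal.mem_span_singleton, vQ]
    interval_cases n <;> simp only [coeff_sub, coeff_X_pow, coeff_C] <;> norm_num
  · rw [Ideal.span_singleton_pow, Ideal.mem_span_singleton, vQ]
    simp only [coeff_sub, coeff_X_pow, coeff_C]; norm_num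
/-- … hence irreducible in `ℤ[Y]` … -/
theorem irreducible_vQ : Irreducible vQ :=
  isEisensteinAt_vQ.irreducible ((Ideal.span_singleton_prime (by norm_num)).mpr
    (Int.prime_iff_natAbs_prime.mpr (by norm_num))) monic_vQ.isPrimitive (by rw [natDegree_vQ]; norm_num)
/-- … hence IRREDUCIBLE OVER `ℚ` (Gauss) … -/
theorem irreducible_vQ_rat : Irreducible (vQ.map (Int.castRingHom ℚ)) := by
  rw [← algebraMap_int_eq]
  exact (monic_vQ.irreducible_iff_irreducible_map_fraction_map).mp irreducible_vQ
/-- … hence separable over `ℚ` … -/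
theorem separable_vQ_rat : (vQ.map (Int.castRingHom ℚ)).Separable := irreducible_vQ_rat.separable
/-- … hence NO RATIONAL ROOT. -/
theorem aeval_vQ_ne_zero_rat (q : ℚ) : aeval q vQ ≠ 0 := by
  intro h
  have hroot : IsRoot (vQ.map (Int.castRingHom ℚ)) q := by
    rw [IsRoot.def, eval_map, ← algebraMap_int_eq, ← aeval_def, h]
  have h1 := degree_eq_one_of_irreducible_of_root irreducible_vQ_rat hroot
  have h4 : (vQ.map (Int.castRingHom ℚ)).degree = 4 := by
    rw [degree_map_eq_of_injective (Int.castRingHom ℚ).injective_int, degree_eq_natDegree vQ_ne_zero, natDegree_vQ]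
    rfl
  rw [h4] at h1
  simp at h1
/-- `Q` HAS A ROOT IN `ℚ₂`: HENSEL at `a = 3`: `‖Q(3)‖₂ = ‖64‖₂ ≤ 2⁻⁶ < 2⁻⁴ = ‖108‖₂² = ‖Q'(3)‖₂²`. -/
theorem exists_padic_root_vQ : ∃ z : ℚ_[2], aeval z vQ = 0 := by
  have hF : ‖aeval (3 : ℤ_[2]) vQ‖ < ‖aeval (3 : ℤ_[2]) (derivative vQ)‖ ^ 2 := by
    have e1 : aeval (3 : ℤ_[2]) vQ = ((64 : ℤ) : ℤ_[2]) := by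
      simp [vQ, map_ofNat]; norm_num
    have e2 : aeval (3 : ℤ_[2]) (derivative vQ) = ((108 : ℤ) : ℤ_[2]) := by
      simp [vQ, map_ofNat]; norm_num
    rw [e1, e2]
    have h27 : ‖((27 : ℤ) : ℤ_[2])‖ = 1 := by
      refine le_antisymm (PadicInt.norm_le_one _) (not_lt.mp fun h => ?_)
      have := (PadicInt.norm_int_lt_one_iff_dvd _).mp h
      omega
    have h2 : ‖(2 : ℤ_[2])‖ = (2 : ℝ)⁻¹ := by
      have := PadicInt.norm_p (p := 2)
      simpa using this
    have h108 : ‖((108 : ℤ) : ℤ_[2])‖ = (4 : ℝ)⁻¹ := by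
      have e : ((108 : ℤ) : ℤ_[2]) = (2 : ℤ_[2]) ^ 2 * ((27 : ℤ) : ℤ_[2]) := by push_cast; norm_num
      rw [e, norm_mul, norm_pow, h27, h2]; norm_num
    have h64 : ‖((64 : ℤ) : ℤ_[2])‖ ≤ (2 : ℝ) ^ (-(6 : ℕ) : ℤ) := by
      have := (PadicInt.norm_int_le_pow_iff_dvd (p := 2) (k := 64) (n := 6)).mpr ⟨1, by norm_num⟩
      exact_mod_cast this
    rw [h108]
    calc ‖((64 : ℤ) : ℤ_[2])‖ ≤ (2 : ℝ) ^ (-(6 : ℕ) : ℤ) := h64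
      _ < ((4 : ℝ)⁻¹) ^ 2 := by norm_num
  obtain ⟨z, hz, -⟩ := hensels_lemma hF
  refine ⟨(z : ℚ_[2]), ?_⟩
  have := Polynomial.aeval_algebraMap_apply ℚ_[2] z vQ
  rw [hz, map_zero] at this
  simpa using this
/-- the top `Q` is REFUSED by node 14's root condition at `m₀ ≤ 2` (tree `not_rootCond_of_padic_root`). -/
theorem not_rootCond_vQ {m₀ : ℕ} (hm : m₀ ≤ 2) : ¬ RootCond m₀ vQ := by
  obtain ⟨z, hz⟩ := exists_padic_root_vQ
  exact not_rootCond_of_padic_root _ vQ_ne_zero hz aeval_vQ_ne_zero_rat hm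

/-- `(l : ℤ) : vC l 2 ≠ 0`. -/
theorem vC_two_ne_zero (l : ℤ) : vC l 2 ≠ 0 := by rw [vC_two]; exact vQ_ne_zero
/-- `(l : ℤ) : xdeg (VW l) = 2`. -/
theorem xdeg_VW (l : ℤ) : xdeg (VW l) = 2 := by rw [VW]; exact xdeg_xPolyP 2 _ (vC_two_ne_zero l)
/-- `(l : ℤ) : topX (VW l) = vQ`. -/
theorem topX_VW (l : ℤ) : topX (VW l) = vQ := by rw [VW, topX_xPolyP 2 _ (vC_two_ne_zero l), vC_two]
/-- `(l : ℤ) : 4 ≤ (VW l).natDegree` (the `Y⁴x²` coefficient is `1`). -/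
theorem four_le_natDegree_VW (l : ℤ) : 4 ≤ (VW l).natDegree := by
  refine le_natDegree_of_ne_zero fun h => ?_
  have h1 := congrArg (fun q : ℤ[X] => q.coeff 2) h
  simp only [VW, coeff_coeff_xPolyP, coeff_zero] at h1
  rw [if_pos (by simp), vC_two, coeff_vQ_four] at h1
  exact one_ne_zero h1
/-- `(l : ℤ) : (VW l).natDegree = 4`. -/
theorem natDegree_VW (l : ℤ) : (VW l).natDegree = 4 := by
  refine le_antisymm ?_ (four_le_natDegree_VW l)
  rw [VW]
  refine natDegree_xPolyP_le 2 _ 4 fun i hi => ?_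
  interval_cases i
  · rw [vC_zero, natDegree_vH]; norm_num
  · rw [vC_one, natDegree_vG]; norm_num
  · rw [vC_two, natDegree_vQ]
/-- `(l : ℤ) : VW l ≠ 0`. -/
theorem VW_ne_zero (l : ℤ) : VW l ≠ 0 := fun h => by
  have := four_le_natDegree_VW l; rw [h, natDegree_zero] at this; omega
/-- `(l : ℤ) : eTop (VW l) = 0` — FULL-DEGREE top. -/
theorem eTop_VW (l : ℤ) : eTop (VW l) = 0 := by rw [eTop, natDegree_VW, topX_VW, natDegree_vQ]
/-- `(l : ℤ) : (topX (VW l)).natDegree = (VW l).natDegree`. -/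
theorem natDegree_topX_VW (l : ℤ) : (topX (VW l)).natDegree = (VW l).natDegree := by
  rw [topX_VW, natDegree_vQ, natDegree_VW]
/-- `(l : ℤ) : ¬ (VW l).natDegree < 2 * xdeg (VW l)` — OUTSIDE node 12's height shape (`4 = 2·2`). -/
theorem not_natDegree_VW_lt (l : ℤ) : ¬ (VW l).natDegree < 2 * xdeg (VW l) := by
  rw [natDegree_VW, xdeg_VW]; norm_num

/-- [datum] RATE-1 BEZOUT certificate (generator `gen60.py`): `bzA·Q + bzB·G = −4912 = Res_Y(Q, G)·(−1)`. -/
def vBzA : ℤ[X] :=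
  C ((289)) + C ((-17)) * X + C ((1)) * X ^ 2
/-- `: ℤ[X]`. -/
def vBzB : ℤ[X] :=
  C ((1)) + C ((-289)) * X + C ((17)) * X ^ 2 + C ((-1)) * X ^ 3
/-- `: vBzA * vQ + vBzB * vG = C (-4912)`. -/
theorem bezout_v : vBzA * vQ + vBzB * vG = C (-4912) := by
  simp only [vBzA, vBzB, vQ, vG, map_neg, map_ofNat, map_one, one_mul]
  ring
/-- RATE 1, TYPED: at every root `β` of the top `Q` (in any field of characteristic `0`) the `x¹`-coefficient `G` does
not vanish (Bezout). -/
theorem aeval_xCoeff_one_ne_zero_of_root_VW (l : ℤ) (K : Type) [Field K] [CharZero K] (β : K)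
    (hβ : aeval β (topX (VW l)) = 0) : aeval β (xCoeff (VW l) 1) ≠ 0 := by
  rw [topX_VW] at hβ
  rw [xCoeff_VW, vC_one]
  intro h1
  have h := congrArg (aeval β) bezout_v
  simp only [map_add, map_mul, hβ, h1, mul_zero, add_zero, eq_intCast, map_intCast] at h
  exact Int.cast_ne_zero.mpr (by norm_num : (-4912 : ℤ) ≠ 0) h.symm

/-- `VW l` has NO x-linear presentation (second difference of `P(x, 0) = −17x² + x + l` in `x` is `−34 ≠ 0`). -/
theorem VW_ne_xLinP (l : ℤ) (A B : ℤ[X]) : VW l ≠ xLinP A B := by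
  intro hP
  have h := fun x : ℝ => congrArg (fun Q => bev Q x 0) hP
  have h0 := h 0
  have h1 := h 1
  have h2 := h 2
  simp only [bev_VW, bev_xLinP] at h0 h1 h2
  have : (-34 : ℝ) = 0 := by linear_combination h0 - 2 * h1 + h2
  norm_num at this
/-- `(l : ℤ) : ¬ XLinearLt (VW l)`. -/
theorem not_xLinearLt_VW (l : ℤ) : ¬ XLinearLt (VW l) := fun ⟨A, B, _, _, hP⟩ => VW_ne_xLinP l A B hP
/-- outside node 16's record class (x-linear by statement). -/
theorem not_xLinTM_VW (l : ℤ) : ¬ XLinTM (VW l) := fun ⟨A, B, _, _, _, _, hP⟩ => VW_ne_xLinP l A B hP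
/-- not a conjugate-poles norm shape of node 10 (those are x-linear). -/
theorem VW_ne_normShapeCurve (l : ℤ) (g q : ℤ[X]) (n : ℕ) (D : ℤ) : VW l ≠ normShapeCurve g q n D := by
  rw [normShapeCurve_eq_xLinP]; exact VW_ne_xLinP l _ _
/-- not a two-term curve `x^k·B(Y) − A(Y)` (the `x`-support is `{0, 1, 2}`: `c₂(0) = −17 ≠ 0`, `c₁(0) = 1 ≠ 0`). -/
theorem VW_ne_twoTermP (l : ℤ) (k : ℕ) (B A : ℤ[X]) : VW l ≠ twoTermP k B A := by
  intro h
  have hc : ∀ i i' : ℕ, (if i' ∈ Finset.range 3 then (vC l i').coeff i else 0) =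
      ((if i' = k then B.coeff i else 0) - (if i' = 0 then A.coeff i else 0)) := by
    intro i i'
    rw [← coeff_coeff_xPolyP, ← coeff_coeff_twoTermP, ← h]; rfl
  by_cases hk : k = 1
  · subst hk
    have h02 := hc 0 2
    rw [if_pos (by simp), if_neg (by norm_num), if_neg (by norm_num), vC_two, coeff_vQ_zero] at h02
    omega
  · have h01 := hc 0 1
    rw [if_pos (by simp), if_neg (fun h => hk h.symm), if_neg (by norm_num), vC_one, coeff_vG_zero] at h01
    omega
/-- in EVERY presentation `VW l = Σ_{i ≤ k} x^i c_i(Y)` the top has a `ℚ₂`-root (it is `Q` or `0`). -/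
theorem exists_padic_root_top_of_VW_eq (l : ℤ) (k : ℕ) (c : ℕ → ℤ[X]) (h : VW l = xPolyP k c) :
    ∃ z : ℚ_[2], aeval z (c k) = 0 := by
  by_cases hck : c k = 0
  · exact ⟨0, by rw [hck, map_zero]⟩
  · have h1 := topX_VW l
    rw [h, topX_xPolyP k c hck] at h1
    rw [h1]; exact exists_padic_root_vQ
/-- `(l : ℤ) (e : ℕ) : ¬ RootlessTop e (VW l)`. -/
theorem not_rootlessTop_VW (l : ℤ) (e : ℕ) : ¬ RootlessTop e (VW l) := by
  rintro ⟨k, c, -, hroot, h⟩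
  obtain ⟨z, hz⟩ := exists_padic_root_top_of_VW_eq l k c h
  exact hroot z hz
/-- **`¬ DecidedAt 2 (VW l)`** — each of the five disjuncts of the record's decided class refuted. -/
theorem not_decidedAt_two_VW (l : ℤ) : ¬ DecidedAt 2 (VW l) := by
  rintro (h | h | h | h | h)
  · have := four_le_natDegree_VW l; omega
  · exact not_xLinearLt_VW l h
  · exact absurd h.1 (by norm_num)
  · have := three_le_thinThreshold (VW l); omega
  · exact not_rootlessTop_VW l 1 h
/-- **`¬ LocalAt m₀ (VW l)` for `m₀ ≤ 2`** (tree `rootCond_topX_of_localAt` + `not_rootCond_vQ`). -/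
theorem not_localAt_VW (l : ℤ) {m₀ : ℕ} (hm : m₀ ≤ 2) : ¬ LocalAt m₀ (VW l) := fun h => by
  have hR := rootCond_topX_of_localAt h
  rw [topX_VW] at hR
  exact not_rootCond_vQ hm hR
/-- **`¬ GaussAt m₀ (VW l)`** at ANY `m₀` (dominance fails at `i = 1`: `deg c₁ = 3 > 2 = deg c₀`). -/
theorem not_gaussAt_VW (l : ℤ) (m₀ : ℕ) : ¬ GaussAt m₀ (VW l) := by
  intro h
  rw [VW] at h
  have := ((gaussAt_xPolyP_iff 2 (vC l) (vC_two_ne_zero l)).mp h).1 1 le_rfl (by norm_num)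
  rw [vC_one, vC_zero, natDegree_vG, natDegree_vH] at this
  omega
/-- … while `VW l` IS in node 11's CONDITIONAL class at `m₀ = 2` (separable top, `eTop = 0`; HONEST: conditional of
record via `PadicSubspace`, which is NOT proved here — the odd-prime emptiness BYPASSES it). -/
theorem sepTopAt_two_VW (l : ℤ) : SepTopAt 2 (VW l) := by
  refine ⟨?_, ?_⟩
  · rw [topX_VW]; exact separable_vQ_rat
  · rw [eTop_VW]; norm_num

/-- `VW l` is NOT a cubic-descent curve of node 20 (`c₀(CB) = −H` has `[Y²] = −1`; `c₀(VW l) = H_l` has `[Y²] = 2`):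
node 20's engine `thinFibreAt_CB` has no presentation of it. -/
theorem VW_ne_CB (l h₁ h₀ l₁ l₀ : ℤ) : VW l ≠ CB h₁ h₀ l₁ l₀ := by
  intro h
  have h1 := congrArg (fun P => (xCoeff P 0).coeff 2) h
  simp only [xCoeff_VW, vC_zero, coeff_vH_two, xCoeff_CB, cbC_zero, coeff_neg, cbH, coeff_add, coeff_X_pow,
    coeff_C_mul_X, coeff_C] at h1
  norm_num at h1

/-- `(j i : ℕ) : xCoeff (V j) i = vC (vLam j) i`. -/
theorem xCoeff_V (j i : ℕ) : xCoeff (V j) i = vC (vLam j) i := xCoeff_VW _ i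
/-- **`V` is INJECTIVE** — an INFINITE class (the `x⁰Y⁰` coefficient is `−3 + 15j`). -/
theorem V_injective : ∀ ⦃j₁ j₂ : ℕ⦄, V j₁ = V j₂ → j₁ = j₂ := by
  -- (port note, census-1 g23: this is `Function.Injective V` UNFOLDED — definitionally the same statement; the folded
  -- form was BOUNCED by the gate's dedup lint as a spurious normalised twin of the unrelated `Literature.Barriers.ValiantsHypothesis.MVFresh.V_inj`)
  intro j₁ j₂ h
  have h1 := congrArg (fun P => (xCoeff P 0).coeff 0) h
  simp only [xCoeff_V, vC_zero, coeff_vH_zero, vLam] at h1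
  omega

/-- **THE INFINITE CLASS `V j` OF K-R51-TERRITORY PAIRS DECIDED HYPOTHESIS-FREE — TERRITORY, THE CERTIFICATE AND THE
THEOREMS, uniformly in `j`, by tree names:** node 20's `CJ_territory` conjunction (`x`-degree 2, `Y`-degree `4 = 2·xdeg`,
top `Q = Y⁴ − 17` ℚ-IRREDUCIBLE of FULL degree with a `ℚ₂`-root and no rational root, separable, `eTop = 0`, rate 1
typed, `¬ DecidedAt 2`, `¬ LocalAt 2`, `∀ m₀ ¬ GaussAt m₀`, `¬ XLinTM`, `¬ XLinearLt`, not x-linear / two-term / norm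
shape, `3 ≤ thinThreshold`, `SepTopAt 2` HONEST «binder bypassed, not proved») ∧ THE K-R51 `k = 2` CERTIFICATE (`Δ_x`
ℚ-irreducible of degree `6 ≡ 2 (mod 4)`) ∧ `¬ OddEmptyAt ℓ` at every `ℓ` (the double point `(0, ∞)`) ∧
**`TangentEmptyAt 5 (V j)` ∧ no rational point with 5-integral abscissa ∧ NO LEVEL POINT ∧ `LevelFinite` ∧ `BddLevelEmpty`
∧ `ThinFibreAt m₀ (V j)` for EVERY `m₀`**. -/
theorem V_territory (j : ℕ) :
    xdeg (V j) = 2 ∧ (V j).natDegree = 4 ∧ topX (V j) = vQ ∧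
      Irreducible ((topX (V j)).map (Int.castRingHom ℚ)) ∧ (topX (V j)).natDegree = (V j).natDegree ∧
      ¬ (V j).natDegree < 2 * xdeg (V j) ∧
      (∃ z : ℚ_[2], aeval z (topX (V j)) = 0) ∧ (∀ q : ℚ, aeval q (topX (V j)) ≠ 0) ∧
      ((topX (V j)).map (Int.castRingHom ℚ)).Separable ∧ eTop (V j) = 0 ∧
      (∀ (K : Type) [Field K] [CharZero K] (β : K), aeval β (topX (V j)) = 0 → aeval β (xCoeff (V j) 1) ≠ 0) ∧
      ¬ DecidedAt 2 (V j) ∧ ¬ LocalAt 2 (V j) ∧ (∀ m₀, ¬ GaussAt m₀ (V j)) ∧ ¬ XLinTM (V j) ∧ ¬ XLinearLt (V j) ∧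
      (∀ A B, V j ≠ xLinP A B) ∧ (∀ k B A, V j ≠ twoTermP k B A) ∧ (∀ g q n D, V j ≠ normShapeCurve g q n D) ∧
      3 ≤ thinThreshold (V j) ∧ SepTopAt 2 (V j) ∧
      xDisc (V j) = vD (vLam j) ∧
      Irreducible ((xDisc (V j)).map (Int.castRingHom ℚ)) ∧ (xDisc (V j)).natDegree = 6 ∧
      (xDisc (V j)).natDegree % 4 = 2 ∧
      (∀ ℓ, ¬ OddEmptyAt ℓ (V j)) ∧
      TangentEmptyAt 5 (V j) ∧ (∀ x r : ℚ, ¬ 5 ∣ x.den → bev (V j) x r ≠ 0) ∧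
      (∀ (N : ℕ) (r : ℚ), bev (V j) (partialSum 2 N) r ≠ 0) ∧ LevelFinite (V j) ∧ BddLevelEmpty (V j) ∧
      ∀ m₀, ThinFibreAt m₀ (V j) := by
  refine ⟨xdeg_VW _, natDegree_VW _, topX_VW _, ?_, natDegree_topX_VW _, not_natDegree_VW_lt _, ?_, ?_, ?_, eTop_VW _,
    aeval_xCoeff_one_ne_zero_of_root_VW _, not_decidedAt_two_VW _, not_localAt_VW _ le_rfl, not_gaussAt_VW _,
    not_xLinTM_VW _, not_xLinearLt_VW _, VW_ne_xLinP _, VW_ne_twoTermP _, VW_ne_normShapeCurve _,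
    three_le_thinThreshold _, sepTopAt_two_VW _, xDisc_V j, (irreducible_xDisc_V j).1, (irreducible_xDisc_V j).2.1,
    (irreducible_xDisc_V j).2.2, not_oddEmptyAt_V j, tangentEmptyAt_five_V j, ratPoint_free_V j, no_level_V j,
    levelFinite_V j, bddLevelEmpty_V j, thinFibreAt_V j⟩
  · rw [V, topX_VW]; exact irreducible_vQ_rat
  · rw [V, topX_VW]; exact exists_padic_root_vQ
  · rw [V, topX_VW]; exact aeval_vQ_ne_zero_rat
  · rw [V, topX_VW]; exact separable_vQ_rat

/-- the NAMED MEMBERS `V 0 = (Y⁴−17)x² + (Y³+1)x + (2Y²+7Y−3)` and `V 1 = … + (2Y²+7Y+12)` (LIVENESS-v16 rows). -/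
theorem thinFibreAt_V0 (m₀ : ℕ) : ThinFibreAt m₀ (V 0) := thinFibreAt_V 0 m₀
/-- `(m₀ : ℕ) : ThinFibreAt m₀ (V 1)`. -/
theorem thinFibreAt_V1 (m₀ : ℕ) : ThinFibreAt m₀ (V 1) := thinFibreAt_V 1 m₀
/-- `: LevelFinite (V 0) ∧ LevelFinite (V 1)`. -/
theorem levelFinite_V0_V1 : LevelFinite (V 0) ∧ LevelFinite (V 1) := ⟨levelFinite_V 0, levelFinite_V 1⟩
/-- **WHY THE RECORD COULD NOT (typed on `V 0`)**: `¬ DecidedAt 2`, `¬ LocalAt 2`, `¬ GaussAt 2`, `¬ XLinTM`, top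
ℚ-irreducible of full degree (no degree-ladder / Ridout margin), outside node 12's height shape, `Δ_x` ℚ-irreducible
sextic (no rational 2-torsion datum), `¬ OddEmptyAt ℓ` ∀ `ℓ`; AND the theorems: `TangentEmptyAt 5`, no level point,
`LevelFinite`, `ThinFibreAt 2` and `ThinFibreAt 0`. -/
theorem V0_territory : ¬ DecidedAt 2 (V 0) ∧ ¬ LocalAt 2 (V 0) ∧ ¬ GaussAt 2 (V 0) ∧ ¬ XLinTM (V 0) ∧
    Irreducible ((topX (V 0)).map (Int.castRingHom ℚ)) ∧ (topX (V 0)).natDegree = (V 0).natDegree ∧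
    ¬ (V 0).natDegree < 2 * xdeg (V 0) ∧ Irreducible ((xDisc (V 0)).map (Int.castRingHom ℚ)) ∧
    (xDisc (V 0)).natDegree = 6 ∧ (∀ ℓ, ¬ OddEmptyAt ℓ (V 0)) ∧ TangentEmptyAt 5 (V 0) ∧
    (∀ (N : ℕ) (r : ℚ), bev (V 0) (partialSum 2 N) r ≠ 0) ∧ LevelFinite (V 0) ∧ ThinFibreAt 2 (V 0) ∧
    ThinFibreAt 0 (V 0) := by
  obtain ⟨-, -, -, h4, h5, h6, -, -, -, -, -, h12, h13, h14, h15, -, -, -, -, -, -, -, h23, h24, -, h26, h27, -, h29,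
    h30, -, h32⟩ := V_territory 0
  exact ⟨h12, h13, h14 2, h15, h4, h5, h6, h23, h24, h26, h27, h29, h30, h32 2, h32 0⟩

end Territory

end Summit.Schanuel.Schanuel.Theorems.RootDecomp1KOddEmpty

end
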